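import Summits.AtomisticToContinuum.BoseEinsteinCondensation.Theorems.GaussianDominationCan.Negative.ProductStates

/-!
# Crux `GaussianDominationCan` — negative-side toolkit III: the constant state and `φ ⊗ c^{⊗(N-1)}`

Support file (crux disprover, `stmt-AtomisticToContinuum-9479`).  The constant state (source
`N^{-1/2}` against the `n = 0` phase, zero free energy) and the NON-symmetric state
`φ ⊗ c^{⊗(N-1)}` (source `N^{-1/2} L³ab`, free energy `(b²L³)·4π²|n|²/L²` independent of `N`),
with the bundle-free energy functional `rawEnergy`.  All [folklore].
-/

noncomputable section

namespace Summit.AtomisticToContinuum.BoseEinsteinCondensation.Theorems.GaussianDominationCan.Negative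

open MeasureTheory Literature.MathematicalPhysics.QuantumManyBody.BoseGas
open scoped ENNReal NNReal ComplexConjugate

variable {N : ℕ} {L : ℝ}

/-! ### The constant state `Φ ≡ L^{-3N/2}` -/

section ConstState

variable {m : ℕ} {c : ℝ}

/-- A constant one-body factor. -/
def constFactor (c : ℝ) : Space → ℂ := fun _ => (c : ℂ)

/-- The cell mean of the constant factor. [folklore] -/
theorem avg_constFactor (hL : 0 < L) (c : ℝ) : avg L (constFactor c) = c := avg_const hL _

/-- The constant factor has zero derivative. [folklore] -/
theorem fderiv_constFactor (c : ℝ) (x : Space) : fderiv ℝ (constFactor c) x = 0 :=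
  fderiv_const_apply _

/-- The constant factor is continuous. [folklore] -/
theorem continuous_constFactor (c : ℝ) : Continuous (constFactor c) := continuous_const

/-- The constant factor is differentiable. [folklore] -/
theorem differentiable_constFactor (c : ℝ) : Differentiable ℝ (constFactor c) :=
  differentiable_const _

/-- The constant `N`-body function `c^N`. -/
def constFun (m : ℕ) (c : ℝ) : Config (m + 1) → ℂ :=
  prodFun (fun _ : Fin (m + 1) => constFactor c)

/-- `∫⁻_cell ‖c‖₊² = c² L³`. [folklore] -/
theorem lintegral_nnnorm_sq_constFactor (L c : ℝ) :
    ∫⁻ x in cell L, (‖constFactor c x‖₊ : ℝ≥0∞) ^ 2 = ENNReal.ofReal (c ^ 2) * ENNReal.ofReal L ^ 3 := by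
  unfold constFactor
  rw [lintegral_cell_const]
  congr 1
  rw [coe_nnnorm_sq_eq_ofReal, Complex.norm_real, Real.norm_eq_abs, sq_abs]

/-- `∫⁻_cell ‖c‖₊² = 1` when `c² L³ = 1`. [folklore] -/
theorem lintegral_nnnorm_sq_constFactor' (hL : 0 < L) (hc : c ^ 2 * L ^ 3 = 1) :
    ∫⁻ x in cell L, (‖constFactor c x‖₊ : ℝ≥0∞) ^ 2 = 1 := by
  rw [lintegral_nnnorm_sq_constFactor, ← ENNReal.ofReal_pow hL.le, ← ENNReal.ofReal_mul (sq_nonneg c),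
    hc, ENNReal.ofReal_one]

/-- The constant state as an admissible periodic Bose trial state (`c² L³ = 1`). -/
def constState (m : ℕ) (hL : 0 < L) (c : ℝ) (hc : c ^ 2 * L ^ 3 = 1) :
    PeriodicTrialState (m + 1) L where
  ψ := constFun m c
  contDiff := contDiff_prodFun fun _ => contDiff_const
  periodic X i k := prodFun_periodic (fun _ _ _ => rfl) X i k
  symm σ X := prodFun_const_symm _ σ X
  norm_eq := by
    show ∫⁻ X in cellN (m + 1) L,
      (‖prodFun (fun _ : Fin (m + 1) => constFactor c) X‖₊ : ℝ≥0∞) ^ 2 = 1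
    rw [lintegral_nnnorm_sq_prodFun (g := fun _ : Fin (m + 1) => constFactor c)
      (fun _ => continuous_constFactor c)]
    simp only [lintegral_nnnorm_sq_constFactor' hL hc, Finset.prod_const_one]

/-- The one-body source integrals of the constant state against the `n = 0` phase. [folklore] -/
theorem integral_sourceFactor_const (hL : 0 < L) (S : Finset (Fin (m + 1))) (i : Fin (m + 1)) :
    ∫ x in cell L, sourceFactor L 0 S (fun _ => constFactor c) i x =
      if i ∈ S then ((L ^ 3 * c ^ 2 : ℝ) : ℂ) else 0 := by
  unfold sourceFactor factorT constFactor
  simp only [cellWave_zero, ite_self, mul_one, avg_const hL, Complex.conj_ofReal]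
  by_cases hiS : i ∈ S
  · simp only [if_pos hiS]
    rw [integral_cell_const hL]
    push_cast
    ring
  · simp only [if_neg hiS, sub_self, mul_zero, integral_zero]

/-- **Source of the constant state against the `n = 0` phase**: `I = N^{-1/2}`. -/
theorem sourceIntegral_constFun (hL : 0 < L) (hc : c ^ 2 * L ^ 3 = 1) :
    sourceIntegral m L 0 (constFun m c) = ((Real.sqrt (m + 1 : ℝ))⁻¹ : ℂ) := by
  unfold constFun
  rw [sourceIntegral_prodFun m L 0 (fun _ : Fin (m + 1) => constFactor c)
      (fun _ => continuous_constFactor c),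
    Finset.sum_eq_single_of_mem (Finset.univ : Finset (Fin (m + 1))) (by simp) ?_]
  · have h1 : ∀ i : Fin (m + 1), ∫ x in cell L,
        sourceFactor L 0 Finset.univ (fun _ : Fin (m + 1) => constFactor c) i x = 1 := by
      intro i
      rw [integral_sourceFactor_const hL, if_pos (Finset.mem_univ i),
        show (L ^ 3 * c ^ 2 : ℝ) = 1 by rw [mul_comm]; exact hc]
      push_cast
      rfl
    simp only [h1, Finset.prod_const_one, mul_one, Finset.card_univ, Fintype.card_fin]
    push_cast
    rfl
  · intro S _ hne
    obtain ⟨i, hi⟩ : ∃ i, i ∉ S := by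
      by_contra h
      exact hne (Finset.eq_univ_iff_forall.mpr fun i => not_not.mp (not_exists.mp h i))
    rw [Finset.prod_eq_zero (Finset.mem_univ i) (by rw [integral_sourceFactor_const hL, if_neg hi]),
      mul_zero]

/-- The constant state has zero kinetic density. [folklore] -/
theorem kineticDensity_constFun (X : Config (m + 1)) : kineticDensity (constFun m c) X = 0 := by
  unfold constFun
  rw [kineticDensity_prodFun (g := fun _ : Fin (m + 1) => constFactor c)
    (fun _ => differentiable_constFactor c)]
  simp [fderiv_constFactor]

/-- The constant state has zero free energy. -/
theorem periodicEnergy_constState (hL : 0 < L) (hc : c ^ 2 * L ^ 3 = 1) :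
    periodicEnergy 0 (constState m hL c hc) = 0 := by
  unfold periodicEnergy
  simp only [periodicInteraction_zero, zero_mul, add_zero]
  show ∫⁻ X in cellN (m + 1) L, kineticDensity (constFun m c) X = 0
  simp_rw [kineticDensity_constFun, lintegral_zero]

end ConstState

/-! ### The non-symmetric state `φ ⊗ c^{⊗(N-1)}` (only particle `0` excited) -/

section NsState

variable {m : ℕ} {n : Fin 3 → ℤ} {a b c : ℝ}

/-- Factors: `φ = a + b e_n` for particle `0`, the constant `c` for the others. -/
def nsFactor (L : ℝ) (n : Fin 3 → ℤ) (a b c : ℝ) (j : Fin (m + 1)) : Space → ℂ :=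
  if j = 0 then oneBody L n a b else constFactor c

/-- `φ ⊗ c^{⊗(N-1)}` — `C¹`, periodic, normalised, NOT Bose-symmetric. -/
def nsFun (m : ℕ) (L : ℝ) (n : Fin 3 → ℤ) (a b c : ℝ) : Config (m + 1) → ℂ :=
  prodFun (nsFactor (m := m) L n a b c)

/-- Factor `0` is `φ`. [folklore] -/
theorem nsFactor_zero (L : ℝ) (n : Fin 3 → ℤ) (a b c : ℝ) :
    nsFactor (m := m) L n a b c 0 = oneBody L n a b := if_pos rfl

/-- Factors `j ≠ 0` are the constant. [folklore] -/
theorem nsFactor_of_ne (L : ℝ) (n : Fin 3 → ℤ) (a b c : ℝ) {j : Fin (m + 1)} (hj : j ≠ 0) :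
    nsFactor L n a b c j = constFactor c := if_neg hj

/-- Every factor is `C¹`. [folklore] -/
theorem contDiff_nsFactor (L : ℝ) (n : Fin 3 → ℤ) (a b c : ℝ) (j : Fin (m + 1)) :
    ContDiff ℝ 1 (nsFactor L n a b c j) := by
  unfold nsFactor; split_ifs; exacts [contDiff_oneBody L n a b, contDiff_const]

/-- Every factor is continuous. [folklore] -/
theorem continuous_nsFactor (L : ℝ) (n : Fin 3 → ℤ) (a b c : ℝ) (j : Fin (m + 1)) :
    Continuous (nsFactor L n a b c j) := (contDiff_nsFactor L n a b c j).continuous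

/-- Every factor is differentiable. [folklore] -/
theorem differentiable_nsFactor (L : ℝ) (n : Fin 3 → ℤ) (a b c : ℝ) (j : Fin (m + 1)) :
    Differentiable ℝ (nsFactor L n a b c j) :=
  (contDiff_nsFactor L n a b c j).differentiable one_ne_zero

/-- Every factor is periodic. [folklore] -/
theorem nsFactor_periodic (hL : L ≠ 0) (j : Fin (m + 1)) (x : Space) (k : Fin 3) :
    nsFactor L n a b c j (x + EuclideanSpace.single k L) = nsFactor L n a b c j x := by
  unfold nsFactor; split_ifs; exacts [oneBody_periodic hL a b x k, rfl]

/-- `φ ⊗ c^{⊗(N-1)}` is `C¹`. [folklore] -/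
theorem contDiff_nsFun (L : ℝ) (n : Fin 3 → ℤ) (a b c : ℝ) : ContDiff ℝ 1 (nsFun m L n a b c) :=
  contDiff_prodFun (contDiff_nsFactor L n a b c)

/-- `φ ⊗ c^{⊗(N-1)}` is periodic in every particle. [folklore] -/
theorem nsFun_periodic (hL : L ≠ 0) (X : Config (m + 1)) (i : Fin (m + 1)) (k : Fin 3) :
    nsFun m L n a b c (X + Pi.single i (EuclideanSpace.single k L)) = nsFun m L n a b c X :=
  prodFun_periodic (fun j x k => nsFactor_periodic hL j x k) X i k

/-- `φ ⊗ c^{⊗(N-1)}` is normalised. [folklore] -/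
theorem lintegral_nnnorm_sq_nsFun (hL : 0 < L) (hn : n ≠ 0) (hab : (a ^ 2 + b ^ 2) * L ^ 3 = 1)
    (hc : c ^ 2 * L ^ 3 = 1) :
    ∫⁻ X in cellN (m + 1) L, (‖nsFun m L n a b c X‖₊ : ℝ≥0∞) ^ 2 = 1 := by
  unfold nsFun
  rw [lintegral_nnnorm_sq_prodFun (continuous_nsFactor L n a b c), Fin.prod_univ_succ,
    nsFactor_zero, lintegral_nnnorm_sq_oneBody hL hn, hab, ENNReal.ofReal_one, one_mul]
  refine Finset.prod_eq_one fun j _ => ?_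
  rw [nsFactor_of_ne L n a b c (Fin.succ_ne_zero j), lintegral_nnnorm_sq_constFactor' hL hc]

/-- The one-body source integrals of `φ ⊗ c^{⊗(N-1)}`. [folklore] -/
theorem integral_sourceFactor_ns (hL : 0 < L) (hn : n ≠ 0) {S : Finset (Fin (m + 1))}
    (hS : (0 : Fin (m + 1)) ∈ S) (i : Fin (m + 1)) :
    ∫ x in cell L, sourceFactor L n S (nsFactor L n a b c) i x =
      if i = 0 then ((L ^ 3 * a * b : ℝ) : ℂ) else if i ∈ S then ((L ^ 3 * c ^ 2 : ℝ) : ℂ) else 0 := by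
  unfold sourceFactor factorT
  by_cases hi0 : i = 0
  · subst hi0
    simp only [if_pos hS, nsFactor_zero, avg_oneBody hL hn, if_true]
    rw [integral_conj_oneBody_wave_mul hL hn a b a]
    push_cast
    ring
  · simp only [if_neg hi0, mul_one, nsFactor_of_ne L n a b c hi0, avg_constFactor hL]
    simp only [constFactor, Complex.conj_ofReal]
    by_cases hiS : i ∈ S
    · simp only [if_pos hiS]
      rw [integral_cell_const hL]
      push_cast
      ring
    · simp only [if_neg hiS, sub_self, mul_zero, integral_zero]

/-- **Source of `φ ⊗ c^{⊗(N-1)}`**: `I = N^{-1/2} L³ a b` (only the all-condensed term survives). -/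
theorem prod_integral_sourceFactor_ns_univ (hL : 0 < L) (hn : n ≠ 0) (hc : c ^ 2 * L ^ 3 = 1) :
    ∏ i, ∫ x in cell L, sourceFactor L n Finset.univ (nsFactor (m := m) L n a b c) i x =
      ((L ^ 3 * a * b : ℝ) : ℂ) := by
  rw [Fin.prod_univ_succ, integral_sourceFactor_ns hL hn (Finset.mem_univ _) 0, if_pos rfl]
  have h : ∀ j : Fin m,
      ∫ x in cell L, sourceFactor L n Finset.univ (nsFactor (m := m) L n a b c) j.succ x = 1 := by
    intro j
    rw [integral_sourceFactor_ns hL hn (Finset.mem_univ _) j.succ, if_neg (Fin.succ_ne_zero j),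
      if_pos (Finset.mem_univ _), show (L ^ 3 * c ^ 2 : ℝ) = 1 by rw [mul_comm]; exact hc]
    push_cast
    rfl
  simp only [h, Finset.prod_const_one, mul_one]

/-- For `S ≠ univ` (with `0 ∈ S`) the `S`-term of the source of `φ ⊗ c^{⊗(N-1)}` vanishes. [folklore] -/
theorem prod_integral_sourceFactor_ns_eq_zero (hL : 0 < L) (hn : n ≠ 0) {S : Finset (Fin (m + 1))}
    (hS : (0 : Fin (m + 1)) ∈ S) (hne : S ≠ Finset.univ) :
    ∏ i, ∫ x in cell L, sourceFactor L n S (nsFactor (m := m) L n a b c) i x = 0 := by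
  obtain ⟨i, hi⟩ : ∃ i, i ∉ S := by
    by_contra h
    exact hne (Finset.eq_univ_iff_forall.mpr fun i => not_not.mp (not_exists.mp h i))
  have hi0 : i ≠ 0 := fun h => hi (h ▸ hS)
  exact Finset.prod_eq_zero (Finset.mem_univ i)
    (by rw [integral_sourceFactor_ns hL hn hS i, if_neg hi0, if_neg hi])

/-- **Source of `φ ⊗ c^{⊗(N-1)}`**: `I = N^{-1/2} L³ a b` (only the all-condensed term survives). -/
theorem sourceIntegral_nsFun (hL : 0 < L) (hn : n ≠ 0) (hc : c ^ 2 * L ^ 3 = 1) :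
    sourceIntegral m L n (nsFun m L n a b c) =
      (((Real.sqrt (m + 1 : ℝ))⁻¹ * (L ^ 3 * a * b) : ℝ) : ℂ) := by
  unfold nsFun
  rw [sourceIntegral_prodFun m L n (nsFactor L n a b c) (continuous_nsFactor L n a b c),
    Finset.sum_eq_single_of_mem (Finset.univ : Finset (Fin (m + 1))) (by simp) ?_]
  · rw [prod_integral_sourceFactor_ns_univ hL hn hc, Finset.card_univ, Fintype.card_fin]
    push_cast
    ring
  · intro S hS hne
    rw [Finset.mem_filter] at hS
    rw [prod_integral_sourceFactor_ns_eq_zero hL hn hS.2 hne, mul_zero]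

/-- `‖I‖ = N^{-1/2} L³ab` for `φ ⊗ c^{⊗(N-1)}`. [folklore] -/
theorem norm_sourceIntegral_nsFun (hL : 0 < L) (hn : n ≠ 0) (ha : 0 ≤ a) (hb : 0 ≤ b)
    (hc : c ^ 2 * L ^ 3 = 1) :
    ‖sourceIntegral m L n (nsFun m L n a b c)‖ = (Real.sqrt (m + 1 : ℝ))⁻¹ * (L ^ 3 * a * b) := by
  rw [sourceIntegral_nsFun hL hn hc, Complex.norm_real, Real.norm_of_nonneg (by positivity)]

/-- The raw energy functional on a bare wave function (`periodicEnergy` without the bundle). -/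
def rawEnergy (v : ℝ → ℝ≥0∞) (N : ℕ) (L : ℝ) (ψ : Config N → ℂ) : ℝ≥0∞ :=
  ∫⁻ X in cellN N L, kineticDensity ψ X + periodicInteraction v L X * ((‖ψ X‖₊ : ℝ≥0∞) ^ 2)

/-- `periodicEnergy` is `rawEnergy` of the underlying function. [folklore] -/
theorem periodicEnergy_eq_rawEnergy {N : ℕ} (v : ℝ → ℝ≥0∞) (Φ : PeriodicTrialState N L) :
    periodicEnergy v Φ = rawEnergy v N L Φ.ψ := rfl

/-- `univ.erase 0 = succ '' univ` in `Fin (m+1)`. [folklore] -/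
theorem univ_erase_zero (m : ℕ) : Finset.univ.erase (0 : Fin (m + 1)) =
    Finset.univ.map ⟨Fin.succ, Fin.succ_injective _⟩ := by
  ext j
  simp only [Finset.mem_erase, Finset.mem_univ, and_true, Finset.mem_map, true_and,
    Function.Embedding.coeFn_mk]
  exact ⟨fun hj => ⟨j.pred hj, Fin.succ_pred j hj⟩, fun ⟨i, hi⟩ => hi ▸ Fin.succ_ne_zero i⟩

/-- Kinetic density of `φ ⊗ c^{⊗(N-1)}` (a constant). [folklore] -/
theorem kineticDensity_nsFun (hL : 0 < L) (X : Config (m + 1)) :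
    kineticDensity (nsFun m L n a b c) X =
      ENNReal.ofReal (c ^ 2) ^ m * ENNReal.ofReal (b ^ 2 * (4 * Real.pi ^ 2 * nsq n / L ^ 2)) := by
  unfold nsFun
  rw [kineticDensity_prodFun (differentiable_nsFactor L n a b c), Fin.sum_univ_succ]
  have hrest : ∀ j : Fin m, (∏ j' ∈ Finset.univ.erase j.succ,
      ((‖nsFactor (m := m) L n a b c j' (X j')‖₊ : ℝ≥0∞) ^ 2)) *
      ∑ k : Fin 3, ((‖fderiv ℝ (nsFactor (m := m) L n a b c j.succ) (X j.succ)
        (EuclideanSpace.single k 1)‖₊ : ℝ≥0∞) ^ 2) = 0 := by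
    intro j
    rw [nsFactor_of_ne L n a b c (Fin.succ_ne_zero j)]
    simp [fderiv_constFactor]
  simp only [hrest, Finset.sum_const_zero, add_zero, nsFactor_zero, sum_nnnorm_sq_fderiv_oneBody hL]
  congr 1
  rw [univ_erase_zero, Finset.prod_map]
  simp only [Function.Embedding.coeFn_mk, nsFactor_of_ne L n a b c (Fin.succ_ne_zero _),
    constFactor, coe_nnnorm_sq_eq_ofReal, Complex.norm_real, Real.norm_eq_abs, sq_abs,
    Finset.prod_const, Finset.card_univ, Fintype.card_fin]

end NsState


/-- **Free energy of `φ ⊗ c^{⊗(N-1)}`**: `(b²L³) · 4π²|n|²/L²`, independent of `N`. [folklore] -/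
theorem rawEnergy_nsFun {m : ℕ} {n : Fin 3 → ℤ} {a b c : ℝ} (hL : 0 < L) (hc : c ^ 2 * L ^ 3 = 1) :
    rawEnergy 0 (m + 1) L (nsFun m L n a b c) =
      ENNReal.ofReal ((b ^ 2 * L ^ 3) * (4 * Real.pi ^ 2 * nsq n / L ^ 2)) := by
  unfold rawEnergy
  simp only [periodicInteraction_zero, zero_mul, add_zero, kineticDensity_nsFun hL]
  rw [setLIntegral_const, volume_cellN]
  have hK : 0 ≤ b ^ 2 * (4 * Real.pi ^ 2 * nsq n / L ^ 2) :=
    mul_nonneg (sq_nonneg _) (div_nonneg (mul_nonneg (by positivity) (nsq_nonneg n)) (sq_nonneg _))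
  have h1 : 0 ≤ (c ^ 2) ^ m * (b ^ 2 * (4 * Real.pi ^ 2 * nsq n / L ^ 2)) :=
    mul_nonneg (pow_nonneg (sq_nonneg c) m) hK
  rw [← ENNReal.ofReal_pow (sq_nonneg c), ← ENNReal.ofReal_pow hL.le,
    ← ENNReal.ofReal_pow (pow_nonneg hL.le 3), ← ENNReal.ofReal_mul (pow_nonneg (sq_nonneg c) m),
    ← ENNReal.ofReal_mul h1]
  congr 1
  calc (c ^ 2) ^ m * (b ^ 2 * (4 * Real.pi ^ 2 * nsq n / L ^ 2)) * (L ^ 3) ^ (m + 1)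
      = (c ^ 2 * L ^ 3) ^ m * ((b ^ 2 * L ^ 3) * (4 * Real.pi ^ 2 * nsq n / L ^ 2)) := by ring
    _ = (b ^ 2 * L ^ 3) * (4 * Real.pi ^ 2 * nsq n / L ^ 2) := by rw [hc, one_pow, one_mul]


end Summit.AtomisticToContinuum.BoseEinsteinCondensation.Theorems.GaussianDominationCan.Negative

end
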